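import Summits.QuantumFields.BalabanUV.Beta.D1BFx.PackedKernelSplit

/-!
# `BalabanUV.Beta.D1BFx.PackedKernelSplitBounds` — road «BF-x» for binder row D1, sub-leaf K-R2-SPLIT (part 2): EVERY BLOCK WORD OF THE
# SPLIT IS A WELL-TYPED (1.22)-KERNEL — (5.10)-shape decay and absolutely summable second moments of the ff part and of `blockTerms`,
# from the decay of the packed leg and the localisation of the vertex families only

HONEST DEPENDENCY (page 1, mandatory): continuum YM on T⁴ ⇐ BetaPertH ∧ nine spine estimates (0/9 proved); BetaPertH ⇐ (D1) ∧ (D4) ∧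
CAP+tail; G-an2-4 gates asym, D1 and NE2/3/4.  HONEST FRAMING (cell contract, verbatim): «discharging `BetaPertH` makes Bałaban's UV
stability UNCONDITIONAL — a real constructive-QFT result; it is NOT the continuum limit and NOT the Clay problem.»  THIS MODULE DISCHARGES
NOTHING of D1 / BetaPertH: [folklore] bookkeeping over `ExpKernelCalculus` §§2–5 (`biLoc_comp_decays`, `biLoc_comp_biLoc`, `abs_tr_le`,
`abs_tadpole_le`, `absMoment₂_hessKer`, `absMoment₂_of_decay510`) and part 1 (`PackedKernelSplit`).  No definition, no `def … : Prop`, no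
citation, no printed statement as hypothesis; 0 binders of the hR/hW roots touched.  NOT summit progress; NOT BetaPertH, NOT continuum, NOT Clay.
ABSOLUTE RULE (cell charter, verbatim): «No internally-minted statement may enter as a cited fact. Every hypothesis is either
kernel-proved in this package or a verbatim quotation of a PUBLISHED theorem with page reference. The manuscript(s) under audit are NOT
citable for their own disputed steps — they are the thing under adjudication; programme-internal (2001/route/tribunal) claims are never
citable.»

WHY (claim table `LEAVES-BFx.md` row K-R2, sub-leaf K-R2-SPLIT; TYPER-SPEC §2 K-R2 + §4 A0).  Part 1 writes the one-loop kernel of a packed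
resolvent as `hessKer K_ff V_ff W_ff + blockTerms K V W` (3 tadpole words + 15 two-leg bubble words).  Node A consumes SECOND MOMENTS of
every term (`DecimatedMomentSummable.AbsMoment₂` — the `hTA` slot), so each word must be a (1.22)-kernel in its own right: this file proves
the two-leg bubble bound, the (5.10)-shape decay of every word at rate `δ/4`, and the summability of the second moments of the ff part and of
`blockTerms` — generic in the packed kernel, and hypothesis-free for the typed `KInv` with any jet datum.  NO `n`-uniformity and NO power
counting is claimed (that is A3.d / A5).

CONTENT (all [folklore]).
* §1 `abs_biBubble_le` (two decaying legs), `abs_sum_le_card_mul`, the dilated-distance factor `exp_blockDist_le` / `exp_blockDist_le_one`.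
* §2 `vertexFamily_blk` / `vertexFamily₂_blk` (blocks of vertex families are vertex families), `decay510_tadpoleWord`, `decay510_biBubbleWord`.
* §3 **`decay510_blockTerms`** (`∃ C′ ≥ 0, Decay510 (blockTerms K V W μ ν) C′ (δ/4)`), **`absMoment₂_blockTerms`**, `decay510_ffPart`, `absMoment₂_ffPart`.
* §4 typed instances, NO hypothesis: `absMoment₂_blockTerms_TOf`, `absMoment₂_ffPart_TOf` (any `d`, `N`, any `JetData`).
Unit `b2b-balaban-beta-d1-formalise-leaf-03` (gen 2), D1 formalisation swarm.
-/

noncomputable section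

namespace Summit.QuantumFields.BalabanUV.Beta.D1BFx.PackedKernelSplitBounds

open Finset
open scoped BigOperators
open Literature.MathematicalPhysics.QuantumFieldTheory.Balaban1983to89
open Literature.MathematicalPhysics.QuantumFieldTheory.Balaban1983to89.Beta
open B12Sec2to5 (l1 l1_nonneg Decay510)
open DecimatedMomentSummable (AbsMoment₂ absMoment₂_of_decay510)
open ExpKernelCalculus (Site MKer Decays BiLoc VertexFamily VertexFamily₂ comp tr bubble tadpole hessKer Zl Zl_nonneg
  biLoc_comp_decays biLoc_comp_biLoc abs_tr_le abs_tadpole_le absMoment₂_hessKer l1_natSmul l1_sub_symm)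
open OneStepResolventKernel (Fib KInv vertexOf JetData TOf decays_KInv vertexFamily_vertexOf')
open Summit.QuantumFields.BalabanUV.Beta.TameKernelCalculus (decays_of_le biLoc_of_le)
open Summit.QuantumFields.BalabanUV.Beta.D1BFx.PackedKernelSplit (blk biBubble ffV ffW blockTerms decays_blk biLoc_blk)

variable {D : ℕ} {F : Type*} [Fintype F]

/-! ## §1 The two-leg bubble bound and two small tools -/

/-- [folklore] **TWO-LEG BUBBLE BOUND**: legs `A`, `B` decaying at rate `δ`, `V` bi-localised at `(p,p)`, `W` at `(q,q)` ⟹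
`|biBubble A V B W| ≤ Cb · e^{−(δ/4)|p−q|₁} · e^{−(δ/4)|p−q|₁}` with the explicit `Cb` of `ExpKernelCalculus.abs_bubble_le` (one `C` per leg). -/
theorem abs_biBubble_le {A V B W : MKer D F} {CA CB Cv Cw δ : ℝ} (hA : Decays A CA δ) (hB : Decays B CB δ) {p q : Site D}
    (hV : BiLoc V p p Cv δ) (hW : BiLoc W q q Cw δ) (hδ : 0 < δ) :
    |biBubble A V B W| ≤
      (Fintype.card F : ℝ) *
          ((Fintype.card F : ℝ) * (((Fintype.card F : ℝ) * (CA * Cv) * Zl D (δ - δ / 2)) *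
              ((Fintype.card F : ℝ) * (CB * Cw) * Zl D (δ - δ / 2))) * Zl D (δ / 2 / 2) *
            Real.exp (-(δ / 2 / 2) * l1 (p - q))) *
        Zl D (δ / 2 / 2) * Real.exp (-(δ / 2 / 2) * l1 (p - q)) := by
  have h1 : BiLoc (comp A V) p p ((Fintype.card F : ℝ) * (CA * Cv) * Zl D (δ - δ / 2)) (δ / 2) :=
    biLoc_comp_decays hA hV (by linarith) (by linarith)
  have h2 : BiLoc (comp B W) q q ((Fintype.card F : ℝ) * (CB * Cw) * Zl D (δ - δ / 2)) (δ / 2) :=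
    biLoc_comp_decays hB hW (by linarith) (by linarith)
  have h3 := biLoc_comp_biLoc h1 h2 (by linarith : 0 < δ / 2)
  exact abs_tr_le h3 (by linarith)

/-- [folklore] A finite sum of uniformly bounded reals: `|Σ_i f i| ≤ |ι| · B`. -/
theorem abs_sum_le_card_mul {ι : Type*} [Fintype ι] (f : ι → ℝ) {B : ℝ} (h : ∀ i, |f i| ≤ B) :
    |∑ i, f i| ≤ (Fintype.card ι : ℝ) * B := by
  calc |∑ i, f i| ≤ ∑ i, |f i| := Finset.abs_sum_le_sum_abs _ _
    _ ≤ ∑ _i : ι, B := Finset.sum_le_sum fun i _ => h i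
    _ = (Fintype.card ι : ℝ) * B := by rw [Finset.sum_const, Finset.card_univ, nsmul_eq_mul]

/-- [folklore] The dilated distance dominates the coarse one: `e^{−(δ/4)·|N•0 − N•z|₁} ≤ e^{−(δ/4)|z|₁}` for `δ ≥ 0`, `N ≥ 1`. -/
theorem exp_blockDist_le {δ : ℝ} (hδ : 0 ≤ δ) {N : ℕ} (hN : 1 ≤ N) (z : Site D) :
    Real.exp (-(δ / 2 / 2) * l1 (((N : ℤ) • (0 : Site D)) - (N : ℤ) • z)) ≤ Real.exp (-(δ / 4) * l1 z) := by
  have hdist : l1 (((N : ℤ) • (0 : Site D)) - (N : ℤ) • z) = (N : ℝ) * l1 z := by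
    rw [smul_zero, zero_sub, ← smul_neg, l1_natSmul]
    congr 1
    simpa using l1_sub_symm (0 : Site D) z
  have hz := l1_nonneg z
  have hN' : (1 : ℝ) ≤ N := by exact_mod_cast hN
  have hmul : l1 z ≤ (N : ℝ) * l1 z := le_mul_of_one_le_left hz hN'
  rw [hdist, Real.exp_le_exp]
  nlinarith

/-- [folklore] … and is at most `1`. -/
theorem exp_blockDist_le_one {δ : ℝ} (hδ : 0 ≤ δ) (N : ℕ) (z : Site D) :
    Real.exp (-(δ / 2 / 2) * l1 (((N : ℤ) • (0 : Site D)) - (N : ℤ) • z)) ≤ 1 := by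
  rw [Real.exp_le_one_iff]
  nlinarith [l1_nonneg (((N : ℤ) • (0 : Site D)) - (N : ℤ) • z)]

/-! ## §2 Blocks of vertex families; decay of the individual words -/

omit [Fintype F] in
/-- [folklore] Blocks of a first-order vertex family form a vertex family (same constants). -/
theorem vertexFamily_blk {V : Fin D → Site D → MKer D (F ⊕ F)} {N : ℕ} {Cv δ : ℝ} (hV : VertexFamily V N Cv δ) (i j : Bool) :
    VertexFamily (fun μ y => blk (V μ y) i j) N Cv δ :=
  fun μ y => biLoc_blk (hV μ y) i j

omit [Fintype F] in
/-- [folklore] Blocks of a second-order vertex family form a second-order vertex family (same constants). -/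
theorem vertexFamily₂_blk {W : Fin D → Site D → Fin D → Site D → MKer D (F ⊕ F)} {N : ℕ} {Cw δ : ℝ} (hW : VertexFamily₂ W N Cw δ)
    (i j : Bool) : VertexFamily₂ (fun μ y ν y' => blk (W μ y ν y') i j) N Cw δ :=
  fun μ y ν y' => biLoc_blk (hW μ y ν y') i j

omit [Fintype F] in
/-- [folklore] The ff parts of vertex families are vertex families. -/
theorem vertexFamily_ffV {V : Fin D → Site D → MKer D (F ⊕ F)} {N : ℕ} {Cv δ : ℝ} (hV : VertexFamily V N Cv δ) :
    VertexFamily (ffV V) N Cv δ :=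
  vertexFamily_blk hV true true

omit [Fintype F] in
/-- [folklore] The ff parts of second-order vertex families are second-order vertex families. -/
theorem vertexFamily₂_ffW {W : Fin D → Site D → Fin D → Site D → MKer D (F ⊕ F)} {N : ℕ} {Cw δ : ℝ} (hW : VertexFamily₂ W N Cw δ) :
    VertexFamily₂ (ffW W) N Cw δ :=
  vertexFamily₂_blk hW true true

/-- [folklore] **A TADPOLE WORD IS A (5.10)-KERNEL**: leg decaying (`C, δ`), table family localised at the coarse bonds (`Cw, δ`), blocking `N ≥ 1`
⟹ `z ↦ tadpole A (W μ 0 ν z)` obeys `Decay510 · (|F|·(|F|·C·Cw·Zl(δ/2))·Zl(δ/4)) (δ/4)`. -/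
theorem decay510_tadpoleWord {A : MKer D F} {W : Fin D → Site D → Fin D → Site D → MKer D F} {C Cw δ : ℝ} {N : ℕ}
    (hA : Decays A C δ) (hW : VertexFamily₂ W N Cw δ) (hδ : 0 < δ) (hN : 1 ≤ N) (μ ν : Fin D) :
    Decay510 (fun z => tadpole A (W μ 0 ν z))
      ((Fintype.card F : ℝ) * ((Fintype.card F : ℝ) * (C * Cw) * Zl D (δ - δ / 2)) * Zl D (δ / 2 / 2)) (δ / 4) := by
  intro z
  rcases isEmpty_or_nonempty F with hF | ⟨⟨a⟩⟩
  · have h0 : tadpole A (W μ 0 ν z) = 0 := by simp [tadpole, tr, Finset.univ_eq_empty]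
    simp only [h0, abs_zero, Fintype.card_eq_zero, Nat.cast_zero, zero_mul, le_refl]
  have hC := hA.nonneg a
  have hCw := (hW μ 0 ν 0).nonneg a
  have hK : 0 ≤ (Fintype.card F : ℝ) * ((Fintype.card F : ℝ) * (C * Cw) * Zl D (δ - δ / 2)) * Zl D (δ / 2 / 2) := by
    have := Zl_nonneg (D := D) (show 0 < δ - δ / 2 by linarith)
    have := Zl_nonneg (D := D) (show 0 < δ / 2 / 2 by linarith)
    positivity
  have ht := abs_tadpole_le hA (hW μ 0 ν z) hδ
  exact ht.trans (mul_le_mul_of_nonneg_left (exp_blockDist_le hδ.le hN z) hK)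

/-- [folklore] **A TWO-LEG BUBBLE WORD IS A (5.10)-KERNEL**: legs `A`, `B` decaying (`CA`, `CB`, rate `δ`), vertex families `V`, `V′` localised at
the coarse bonds (`Cv`, `Cv′`, rate `δ`), `N ≥ 1` ⟹ `z ↦ biBubble A (V μ 0) B (V′ ν z)` obeys `Decay510 · Kb (δ/4)` with the explicit `Kb` below. -/
theorem decay510_biBubbleWord {A B : MKer D F} {V V' : Fin D → Site D → MKer D F} {CA CB Cv Cv' δ : ℝ} {N : ℕ}
    (hA : Decays A CA δ) (hB : Decays B CB δ) (hV : VertexFamily V N Cv δ) (hV' : VertexFamily V' N Cv' δ) (hδ : 0 < δ)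
    (hN : 1 ≤ N) (μ ν : Fin D) :
    Decay510 (fun z => biBubble A (V μ 0) B (V' ν z))
      ((Fintype.card F : ℝ) * ((Fintype.card F : ℝ) * (((Fintype.card F : ℝ) * (CA * Cv) * Zl D (δ - δ / 2)) *
        ((Fintype.card F : ℝ) * (CB * Cv') * Zl D (δ - δ / 2))) * Zl D (δ / 2 / 2)) * Zl D (δ / 2 / 2)) (δ / 4) := by
  intro z
  rcases isEmpty_or_nonempty F with hF | ⟨⟨a⟩⟩
  · have h0 : biBubble A (V μ 0) B (V' ν z) = 0 := by simp [biBubble, tr, Finset.univ_eq_empty]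
    simp only [h0, abs_zero, Fintype.card_eq_zero, Nat.cast_zero, zero_mul, le_refl]
  have hCA := hA.nonneg a
  have hCB := hB.nonneg a
  have hCv := (hV μ 0).nonneg a
  have hCv' := (hV' ν 0).nonneg a
  have hZA := Zl_nonneg (D := D) (show 0 < δ - δ / 2 by linarith)
  have hZB := Zl_nonneg (D := D) (show 0 < δ / 2 / 2 by linarith)
  set Kb : ℝ := (Fintype.card F : ℝ) * ((Fintype.card F : ℝ) * (((Fintype.card F : ℝ) * (CA * Cv) * Zl D (δ - δ / 2)) *
        ((Fintype.card F : ℝ) * (CB * Cv') * Zl D (δ - δ / 2))) * Zl D (δ / 2 / 2)) * Zl D (δ / 2 / 2) with hKbdef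
  have hKb : 0 ≤ Kb := by rw [hKbdef]; positivity
  set E := Real.exp (-(δ / 2 / 2) * l1 (((N : ℤ) • (0 : Site D)) - (N : ℤ) • z)) with hEdef
  have hE : 0 ≤ E := (Real.exp_pos _).le
  have hE1 : E ≤ 1 := exp_blockDist_le_one hδ.le N z
  have hEE' : E ≤ Real.exp (-(δ / 4) * l1 z) := exp_blockDist_le hδ.le hN z
  have hb := abs_biBubble_le hA hB (hV μ 0) (hV' ν z) hδ
  refine hb.trans ?_
  have hrw : (Fintype.card F : ℝ) * ((Fintype.card F : ℝ) * (((Fintype.card F : ℝ) * (CA * Cv) * Zl D (δ - δ / 2)) *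
        ((Fintype.card F : ℝ) * (CB * Cv') * Zl D (δ - δ / 2))) * Zl D (δ / 2 / 2) * E) * Zl D (δ / 2 / 2) * E = Kb * (E * E) := by
    rw [hKbdef]; ring
  rw [hrw]
  refine mul_le_mul_of_nonneg_left ?_ hKb
  calc E * E ≤ E * 1 := mul_le_mul_of_nonneg_left hE1 hE
    _ ≤ Real.exp (-(δ / 4) * l1 z) := by rw [mul_one]; exact hEE'

/-! ## §3 The block terms and the ff part are (1.22)-kernels -/

/-- [folklore] **(5.10)-SHAPE DECAY OF THE BLOCK TERMS**: for a packed leg `K` decaying (`C, δ`), packed vertex families `V` (`Cv, δ`),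
`W` (`Cw, δ`) at blocking `N ≥ 1`, every channel `z ↦ blockTerms K V W μ ν z` obeys `Decay510 · C′ (δ/4)` for an explicit `C′ ≥ 0`
(4 tadpole-word bounds + 16 bubble-word bounds; the guarded words contribute `0`). -/
theorem decay510_blockTerms {K : MKer D (F ⊕ F)} {V : Fin D → Site D → MKer D (F ⊕ F)}
    {W : Fin D → Site D → Fin D → Site D → MKer D (F ⊕ F)} {C Cv Cw δ : ℝ} {N : ℕ}
    (hK : Decays K C δ) (hV : VertexFamily V N Cv δ) (hW : VertexFamily₂ W N Cw δ) (hδ : 0 < δ) (hN : 1 ≤ N) (μ ν : Fin D) :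
    ∃ C' : ℝ, 0 ≤ C' ∧ Decay510 (blockTerms K V W μ ν) C' (δ / 4) := by
  -- the two word constants (fibre `F` of the blocks)
  set Kt : ℝ := (Fintype.card F : ℝ) * ((Fintype.card F : ℝ) * (C * Cw) * Zl D (δ - δ / 2)) * Zl D (δ / 2 / 2) with hKtdef
  set Kb : ℝ := (Fintype.card F : ℝ) * ((Fintype.card F : ℝ) * (((Fintype.card F : ℝ) * (C * Cv) * Zl D (δ - δ / 2)) *
        ((Fintype.card F : ℝ) * (C * Cv) * Zl D (δ - δ / 2))) * Zl D (δ / 2 / 2)) * Zl D (δ / 2 / 2) with hKbdef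
  rcases isEmpty_or_nonempty F with hF | ⟨⟨a⟩⟩
  · refine ⟨0, le_rfl, fun z => ?_⟩
    have h0 : blockTerms K V W μ ν z = 0 := by
      simp [blockTerms, tadpole, biBubble, tr, Finset.univ_eq_empty]
    rw [h0, abs_zero, zero_mul]
  have hC := hK.nonneg (Sum.inl a)
  have hCv := (hV μ 0).nonneg (Sum.inl a)
  have hCw := (hW μ 0 ν 0).nonneg (Sum.inl a)
  have hZA := Zl_nonneg (D := D) (show 0 < δ - δ / 2 by linarith)
  have hZB := Zl_nonneg (D := D) (show 0 < δ / 2 / 2 by linarith)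
  have hKt : 0 ≤ Kt := by rw [hKtdef]; positivity
  have hKb : 0 ≤ Kb := by rw [hKbdef]; positivity
  refine ⟨1 / 2 * (2 * (2 * Kt)) + 1 / 2 * (2 * (2 * (2 * (2 * Kb)))), by positivity, fun z => ?_⟩
  set E' := Real.exp (-(δ / 4) * l1 z) with hE'def
  have hE' : 0 ≤ E' := (Real.exp_pos _).le
  -- every tadpole word
  have ht : ∀ i j : Bool, |(bif (i && j) then (0 : ℝ) else tadpole (blk K i j) (blk (W μ 0 ν z) j i))| ≤ Kt * E' := by
    intro i j
    cases (i && j)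
    · exact (decay510_tadpoleWord (decays_blk hK i j) (vertexFamily₂_blk hW j i) hδ hN μ ν) z
    · rw [cond_true, abs_zero]; positivity
  -- every bubble word
  have hb : ∀ i j k l : Bool, |(bif (i && j && k && l) then (0 : ℝ) else
      biBubble (blk K i j) (blk (V μ 0) j k) (blk K k l) (blk (V ν z) l i))| ≤ Kb * E' := by
    intro i j k l
    cases (i && j && k && l)
    · exact (decay510_biBubbleWord (decays_blk hK i j) (decays_blk hK k l) (vertexFamily_blk hV j k) (vertexFamily_blk hV l i)
        hδ hN μ ν) z
    · rw [cond_true, abs_zero]; positivity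
  have hT : |∑ i : Bool, ∑ j : Bool, (bif (i && j) then (0 : ℝ) else tadpole (blk K i j) (blk (W μ 0 ν z) j i))| ≤ 2 * (2 * (Kt * E')) := by
    have h := abs_sum_le_card_mul (fun i : Bool => ∑ j : Bool, (bif (i && j) then (0 : ℝ) else tadpole (blk K i j) (blk (W μ 0 ν z) j i)))
      (fun i => abs_sum_le_card_mul _ (fun j => ht i j))
    simpa only [Fintype.card_bool, Nat.cast_ofNat] using h
  have hB : |∑ i : Bool, ∑ j : Bool, ∑ k : Bool, ∑ l : Bool, (bif (i && j && k && l) then (0 : ℝ) else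
      biBubble (blk K i j) (blk (V μ 0) j k) (blk K k l) (blk (V ν z) l i))| ≤ 2 * (2 * (2 * (2 * (Kb * E')))) := by
    have h := abs_sum_le_card_mul
      (fun i : Bool => ∑ j : Bool, ∑ k : Bool, ∑ l : Bool, (bif (i && j && k && l) then (0 : ℝ) else
        biBubble (blk K i j) (blk (V μ 0) j k) (blk K k l) (blk (V ν z) l i)))
      (fun i => abs_sum_le_card_mul _ (fun j => abs_sum_le_card_mul _ (fun k => abs_sum_le_card_mul _ (fun l => hb i j k l))))
    simpa only [Fintype.card_bool, Nat.cast_ofNat] using h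
  show |blockTerms K V W μ ν z| ≤ _
  unfold blockTerms
  calc |1 / 2 * (∑ i : Bool, ∑ j : Bool, (bif (i && j) then (0 : ℝ) else tadpole (blk K i j) (blk (W μ 0 ν z) j i)))
          - 1 / 2 * (∑ i : Bool, ∑ j : Bool, ∑ k : Bool, ∑ l : Bool, (bif (i && j && k && l) then (0 : ℝ) else
              biBubble (blk K i j) (blk (V μ 0) j k) (blk K k l) (blk (V ν z) l i)))|
        ≤ |1 / 2 * (∑ i : Bool, ∑ j : Bool, (bif (i && j) then (0 : ℝ) else tadpole (blk K i j) (blk (W μ 0 ν z) j i)))|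
          + |1 / 2 * (∑ i : Bool, ∑ j : Bool, ∑ k : Bool, ∑ l : Bool, (bif (i && j && k && l) then (0 : ℝ) else
              biBubble (blk K i j) (blk (V μ 0) j k) (blk K k l) (blk (V ν z) l i)))| := abs_sub _ _
    _ ≤ 1 / 2 * (2 * (2 * (Kt * E'))) + 1 / 2 * (2 * (2 * (2 * (2 * (Kb * E'))))) := by
        rw [abs_mul, abs_mul, abs_of_pos (by norm_num : (0 : ℝ) < 1 / 2)]
        gcongr
    _ = (1 / 2 * (2 * (2 * Kt)) + 1 / 2 * (2 * (2 * (2 * (2 * Kb))))) * E' := by ring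

/-- [folklore] **THE BLOCK TERMS HAVE ABSOLUTELY SUMMABLE SECOND MOMENTS** (the `hTA` slot of the endpoint theorems for each block word sum). -/
theorem absMoment₂_blockTerms {K : MKer D (F ⊕ F)} {V : Fin D → Site D → MKer D (F ⊕ F)}
    {W : Fin D → Site D → Fin D → Site D → MKer D (F ⊕ F)} {C Cv Cw δ : ℝ} {N : ℕ}
    (hK : Decays K C δ) (hV : VertexFamily V N Cv δ) (hW : VertexFamily₂ W N Cw δ) (hδ : 0 < δ) (hN : 1 ≤ N) (μ ν : Fin D) :
    AbsMoment₂ (blockTerms K V W μ ν) := by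
  obtain ⟨C', -, h⟩ := decay510_blockTerms hK hV hW hδ hN μ ν
  exact absMoment₂_of_decay510 (by linarith) h

/-- [folklore] **THE ff PART IS A (5.10)-KERNEL** (`ExpKernelCalculus.decay510_hessKer` on the ff blocks). -/
theorem decay510_ffPart {K : MKer D (F ⊕ F)} {V : Fin D → Site D → MKer D (F ⊕ F)}
    {W : Fin D → Site D → Fin D → Site D → MKer D (F ⊕ F)} {C Cv Cw δ : ℝ} {N : ℕ}
    (hK : Decays K C δ) (hV : VertexFamily V N Cv δ) (hW : VertexFamily₂ W N Cw δ) (hδ : 0 < δ) (hN : 1 ≤ N) (μ ν : Fin D) :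
    ∃ C' : ℝ, 0 ≤ C' ∧ Decay510 (hessKer (blk K true true) (ffV V) (ffW W) μ ν) C' (δ / 4) :=
  ExpKernelCalculus.decay510_hessKer (decays_blk hK true true) (vertexFamily_ffV hV) (vertexFamily₂_ffW hW) hδ hN μ ν

/-- [folklore] **THE ff PART HAS ABSOLUTELY SUMMABLE SECOND MOMENTS**. -/
theorem absMoment₂_ffPart {K : MKer D (F ⊕ F)} {V : Fin D → Site D → MKer D (F ⊕ F)}
    {W : Fin D → Site D → Fin D → Site D → MKer D (F ⊕ F)} {C Cv Cw δ : ℝ} {N : ℕ}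
    (hK : Decays K C δ) (hV : VertexFamily V N Cv δ) (hW : VertexFamily₂ W N Cw δ) (hδ : 0 < δ) (hN : 1 ≤ N) (μ ν : Fin D) :
    AbsMoment₂ (hessKer (blk K true true) (ffV V) (ffW W) μ ν) :=
  absMoment₂_hessKer (decays_blk hK true true) (vertexFamily_ffV hV) (vertexFamily₂_ffW hW) hδ hN μ ν

/-! ## §4 The typed packed resolvent: no hypothesis -/

section Typed

variable {d N : ℕ} [NeZero N]

/-- [folklore] Common-rate data for the typed packed resolvent and a jet datum: a decay bound of `KInv`, a vertex-family bound of
`vertexOf J.S` and the datum's `loc₂`, all at ONE positive rate. -/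
theorem commonRate (J : JetData d N) :
    ∃ C Cv Cw m : ℝ, 0 < m ∧ Decays (KInv (N := N) (d := d)) C m ∧ VertexFamily (vertexOf (N := N) J.S) N Cv m ∧
      VertexFamily₂ J.W N Cw m := by
  obtain ⟨δK, CK, hδK, -, hK⟩ := decays_KInv (N := N) (d := d)
  obtain ⟨Cv, δv, hδv, hV⟩ := vertexFamily_vertexOf' (N := N) J.loc J.δ_pos
  set m : ℝ := min δK (min δv J.δ) with hm
  have hmK : m ≤ δK := min_le_left _ _
  have hmv : m ≤ δv := (min_le_right _ _).trans (min_le_left _ _)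
  have hmw : m ≤ J.δ := (min_le_right _ _).trans (min_le_right _ _)
  refine ⟨|CK|, |Cv|, |J.Cw|, m, lt_min hδK (lt_min hδv J.δ_pos), decays_of_le hK hmK, fun μ y => biLoc_of_le (hV μ y) hmv,
    fun μ y ν y' => biLoc_of_le (J.loc₂ μ y ν y') hmw⟩

/-- [folklore] **THE BLOCK TERMS OF THE TYPED KERNEL ARE WELL-TYPED** — `AbsMoment₂ (blockTerms KInv (vertexOf J.S) J.W μ ν)` for every
jet datum, every blocking `N ≥ 1`, every dimension; NO hypothesis. -/
theorem absMoment₂_blockTerms_TOf (J : JetData d N) (μ ν : Fin (d + 1)) :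
    AbsMoment₂ (blockTerms (KInv (N := N) (d := d)) (vertexOf (N := N) J.S) J.W μ ν) := by
  obtain ⟨C, Cv, Cw, m, hm, hK, hV, hW⟩ := commonRate J
  exact absMoment₂_blockTerms hK hV hW hm NeZero.one_le μ ν

/-- [folklore] **THE ff PART OF THE TYPED KERNEL IS WELL-TYPED** — NO hypothesis. -/
theorem absMoment₂_ffPart_TOf (J : JetData d N) (μ ν : Fin (d + 1)) :
    AbsMoment₂ (hessKer (blk (KInv (N := N) (d := d)) true true) (ffV (vertexOf (N := N) J.S)) (ffW J.W) μ ν) := by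
  obtain ⟨C, Cv, Cw, m, hm, hK, hV, hW⟩ := commonRate J
  exact absMoment₂_ffPart hK hV hW hm NeZero.one_le μ ν

end Typed

end Summit.QuantumFields.BalabanUV.Beta.D1BFx.PackedKernelSplitBounds

end
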